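import Summits.MatrixMultiplication.MatrixMultiplication.Theorems.FarEdgeDescentPencilCharForm
import HarnessLib

/-!
# Pencil Gram invariants of the BCZ line, V: the closed line is a total antichain over EVERY field

Route `FarEdgeDescent` (cell `decomp-mm`, lens 2 «structural dichotomy (special vs generic)»,
gen 40), Kernel XV-b; support for the aside `SubLogRate` (stmt-MatrixMultiplication-25371).

Part II (`FarEdgeDescentLineAntichain`) decided the degeneration order on the closed BCZ line
`{𝔖(q) : q ∈ K}` — the `(GL₄)³`-normal forms of the same-support class of `⟨2,2,2⟩`
(Bläser–Christandl–Zuiddam, §2) — in characteristic `≠ 2`.  With the every-field pencil lemma of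
Part IV (`FarEdgeDescentPencilCharForm.pencil_caseA/B`: the full characteristic form
`det(a S_p + b S_q) = det B² det Ĵ_1 (a+b)²(ap+bq)²` evaluated at `t = ±ε^{|a₁-a₂|}`, endgame
`(κ₁+κ₂)² = κ₁² = (κ₁-κ₂)² ⟹ κ₂ = 0` with no division by `2`) the hypothesis `(2 : K) ≠ 0`
disappears everywhere:

* `fam_not_algDegeneratesTo_fam_zero`: **`𝔖(q) ⋭ 𝔖(0)` for every `q ≠ 0`, every field**;
  `fam_zero_isolated`;
* `fam_algDegeneratesTo_fam_iff`: **`𝔖(q) ⊵ 𝔖(q') ↔ q' = q ∨ q q' = 1` for ALL `q, q'` over EVERY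
  field** — degeneration = restriction = the inversion involution on the whole closed line
  (`fam_algDegeneratesTo_iff_restrictsTo`), no strict degeneration (`no_strict_degeneration`),
  comparable iff mutually restricting (`comparable_iff`);
* the characteristic-`2` instances `fam_algDegeneratesTo_fam_iff_zmod2`, `line_zmod2`: over `𝔽₂`
  the closed line is `{𝔖(0), 𝔖(1) ≅ ⟨2,2,2⟩}`, two `⊴`-incomparable points — the statements say
  something exactly where Part II was silent (over `ℂ` see Part II,
  `fam_algDegeneratesTo_fam_iff_complex`).

Lens reading (special vs generic): inside the same-support class of `⟨2,2,2⟩` no member — special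
(`q ∈ {0,1}`) or generic — degenerates to any other, over any field whatsoever; every transfer of
asymptotic rank along the line is genuinely asymptotic (`N → ∞`), which is where the cut
`FiniteSaturation ∧ AnchoredLogConvexity ⟹ ω = 2` lives.

References: P. Bürgisser, M. Clausen, M. A. Shokrollahi, *Algebraic Complexity Theory* (1997),
(15.19), (15.25), §20.2 [BurgisserClausenShokrollahi1997]; M. Bläser, M. Christandl, J. Zuiddam,
arXiv:1705.09652, §2, Lemma 3 [BlaserChristandlZuiddam2017]; W. V. D. Hodge, D. Pedoe, *Methods of
Algebraic Geometry* II (1952), Book IV, Ch. XIII §10–11 [HodgePedoe1994].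
-/

noncomputable section

open scoped BigOperators Polynomial Matrix

set_option linter.dupNamespace false

namespace Summit.MatrixMultiplication.MatrixMultiplication.Theorems.FarEdgeDescentLineAllChar

open Literature.Computability.AlgebraicComplexity
open Summit.MatrixMultiplication.MatrixMultiplication.Theorems.FarEdgeDescentSignTwistDet
open Summit.MatrixMultiplication.MatrixMultiplication.Theorems.FarEdgeDescentWeightFamily
  (famW fam fam_one)
open Summit.MatrixMultiplication.MatrixMultiplication.Theorems.FarEdgeDescentWeightFamilyDet
open Summit.MatrixMultiplication.MatrixMultiplication.Theorems.FarEdgeDescentLineDetPair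
open Summit.MatrixMultiplication.MatrixMultiplication.Theorems.FarEdgeDescentLineRigidity
  (trailing_identity trailing_isHomogeneous fam_zero_not_algDegeneratesTo_fam)
open Summit.MatrixMultiplication.MatrixMultiplication.Theorems.FarEdgeDescentPencilGram
open Summit.MatrixMultiplication.MatrixMultiplication.Theorems.FarEdgeDescentStratumSymmetries
  (fam_restrictsTo_fam_inv)
open Summit.MatrixMultiplication.MatrixMultiplication.Theorems.FarEdgeDescentPencilCharForm
  (pencil_caseA pencil_caseB)

universe u

/-! ## `𝔖(q) ⋭ 𝔖(0)` over every field -/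

section Main
variable (K : Type u) [Field K]

/-- **`𝔖(q) ⋭ 𝔖(0)` for every `q ≠ 0`, over EVERY field** (Part II needed `char K ≠ 2`).
[cite: BurgisserClausenShokrollahi1997, (15.19)] [cite: BlaserChristandlZuiddam2017, §2]
[cite: HodgePedoe1994, Bk IV Ch. XIII §10] -/
theorem fam_not_algDegeneratesTo_fam_zero {q : K} (hq0 : q ≠ 0) :
    ¬ AlgDegeneratesTo (fam K q) (fam K 0) := by
  rintro ⟨h, A, B, C, hd⟩
  obtain ⟨c, htc⟩ := trailing_identity K hd
  obtain ⟨hP, hQ⟩ := trailing_isHomogeneous K B q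
  have e1 : yv B (0, 0) * yv B (1, 1) - yv B (0, 1) * yv B (1, 0) =
      yv B (0, 0) * yv B (1, 1) - yv B (0, 1) * yv B (1, 0) *
        Polynomial.C (MvPolynomial.C (1 : K)) := by
    rw [map_one, map_one, mul_one]
  rcases pair_of_detX_mul_eq hP hQ (detXq_ne_zero K 0) htc with
    ⟨⟨κ₁, hκ₁, e₁⟩, ⟨κ₂, hκ₂, e₂⟩⟩ | ⟨⟨κ₁, hκ₁, e₁⟩, ⟨κ₂, hκ₂, e₂⟩⟩
  · rw [← detXq_one, e1] at e₁
    obtain ⟨S₁, hS₁, hS₁0⟩ := gram_decomp e₁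
    obtain ⟨S₂, hS₂, hS₂0⟩ := gram_decomp e₂
    rw [map_one] at hS₁
    exact pencil_caseA hq0 hκ₁ hκ₂ hS₁ hS₁0 hS₂ hS₂0
  · rw [e1] at e₁
    rw [← detXq_one] at e₂
    obtain ⟨S₁, hS₁, hS₁0⟩ := gram_decomp e₁
    obtain ⟨S₂, hS₂, hS₂0⟩ := gram_decomp e₂
    rw [map_one] at hS₁
    exact pencil_caseB hq0 hκ₁ hκ₂ hS₁ hS₁0 hS₂ hS₂0

/-- **`𝔖(0)` is `⊴`-isolated on the closed line**, every field:
`𝔖(q) ⊵ 𝔖(0) ↔ q = 0 ↔ 𝔖(0) ⊵ 𝔖(q)`. [cite: BurgisserClausenShokrollahi1997, (15.19)] -/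
theorem fam_zero_isolated (q : K) :
    (AlgDegeneratesTo (fam K q) (fam K 0) ↔ q = 0) ∧
      (AlgDegeneratesTo (fam K 0) (fam K q) ↔ q = 0) := by
  refine ⟨⟨fun hd => by_contra fun hq => fam_not_algDegeneratesTo_fam_zero K hq hd,
    fun e => ?_⟩, ⟨fun hd => by_contra fun hq => fam_zero_not_algDegeneratesTo_fam K hq hd,
    fun e => ?_⟩⟩
  · rw [e]
    exact (TensorRestrictsTo.refl _).algDegeneratesTo
  · rw [e]
    exact (TensorRestrictsTo.refl _).algDegeneratesTo

end Main

/-! ## The degeneration order on the whole closed line, every field -/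

section Line
variable (K : Type) [Field K]

/-- **The degeneration order on the closed BCZ line, no proviso, EVERY field**:
`𝔖(q) ⊵ 𝔖(q') ↔ q' = q ∨ q q' = 1` for all `q, q'`.
[cite: BlaserChristandlZuiddam2017, §2] [cite: BurgisserClausenShokrollahi1997, (15.19), §20.2] -/
theorem fam_algDegeneratesTo_fam_iff (q q' : K) :
    AlgDegeneratesTo (fam K q) (fam K q') ↔ q' = q ∨ q * q' = 1 := by
  by_cases hq'0 : q' = 0
  · subst hq'0
    refine ⟨fun hd => ?_, ?_⟩
    · by_cases hq : q = 0
      · exact Or.inl hq.symm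
      · exact absurd hd (fam_not_algDegeneratesTo_fam_zero K hq)
    · rintro (e | e)
      · rw [← e]
        exact (TensorRestrictsTo.refl _).algDegeneratesTo
      · rw [mul_zero] at e
        exact absurd e zero_ne_one
  · exact FarEdgeDescentLineRigidity.fam_algDegeneratesTo_fam_iff K fun e => absurd e hq'0

/-- **On the closed line degeneration is restriction**, every field.
[cite: BurgisserClausenShokrollahi1997, §20.2] -/
theorem fam_algDegeneratesTo_iff_restrictsTo (q q' : K) :
    AlgDegeneratesTo (fam K q) (fam K q') ↔ TensorRestrictsTo (fam K q) (fam K q') := by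
  refine ⟨fun hd => ?_, fun h => h.algDegeneratesTo⟩
  rcases (fam_algDegeneratesTo_fam_iff K q q').mp hd with e | h
  · rw [e]
    exact TensorRestrictsTo.refl _
  · have hq0 : q ≠ 0 := fun e => zero_ne_one (by rwa [e, zero_mul] at h)
    rw [eq_inv_of_mul_eq_one_right h]
    exact fam_restrictsTo_fam_inv hq0

/-- **The closed line is a total antichain over every field**: `𝔖(q) ⊵ 𝔖(q') ↔ 𝔖(q') ⊵ 𝔖(q)`;
no strict degeneration exists. [cite: BurgisserClausenShokrollahi1997, §20.2] -/
theorem no_strict_degeneration (q q' : K) :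
    AlgDegeneratesTo (fam K q) (fam K q') ↔ AlgDegeneratesTo (fam K q') (fam K q) := by
  rw [fam_algDegeneratesTo_fam_iff K, fam_algDegeneratesTo_fam_iff K]
  constructor <;> rintro (e | h)
  · exact Or.inl e.symm
  · exact Or.inr (by rwa [mul_comm] at h)
  · exact Or.inl e.symm
  · exact Or.inr (by rwa [mul_comm] at h)

/-- **The classes of the line**, every field: `𝔖(q)`, `𝔖(q')` are `⊴`-comparable iff they are
mutual restrictions (iff `q' ∈ {q, q⁻¹}`). [cite: BlaserChristandlZuiddam2017, §2] -/
theorem comparable_iff (q q' : K) :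
    (AlgDegeneratesTo (fam K q) (fam K q') ∨ AlgDegeneratesTo (fam K q') (fam K q)) ↔
      (TensorRestrictsTo (fam K q) (fam K q') ∧ TensorRestrictsTo (fam K q') (fam K q)) := by
  rw [← fam_algDegeneratesTo_iff_restrictsTo K, ← fam_algDegeneratesTo_iff_restrictsTo K,
    ← no_strict_degeneration K q q', or_self, and_self]

/-- **Characteristic `2`** (where Part II said nothing): over `𝔽₂`,
`𝔖(q) ⊵ 𝔖(q') ↔ q' = q` — the closed line `{𝔖(0), 𝔖(1) ≅ ⟨2,2,2⟩}` is two incomparable points.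
[cite: BlaserChristandlZuiddam2017, §2] -/
theorem fam_algDegeneratesTo_fam_iff_zmod2 (q q' : ZMod 2) :
    AlgDegeneratesTo (fam (ZMod 2) q) (fam (ZMod 2) q') ↔ q' = q := by
  rw [fam_algDegeneratesTo_fam_iff]
  constructor
  · rintro (e | h)
    · exact e
    · revert q q' h
      decide
  · exact fun e => Or.inl e

/-- **Over `𝔽₂`: `⟨2,2,2⟩ ≅ 𝔖(1)` and `⟨2,2,2⟩` minus a term `𝔖(0)` are `⊴`-incomparable, and these
are the only two members of the closed line.** [cite: BlaserChristandlZuiddam2017, §2] -/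
theorem line_zmod2 :
    ¬ AlgDegeneratesTo (fam (ZMod 2) 1) (fam (ZMod 2) 0) ∧
      ¬ AlgDegeneratesTo (fam (ZMod 2) 0) (fam (ZMod 2) 1) ∧
        ∀ q : ZMod 2, q = 0 ∨ q = 1 := by
  refine ⟨fun hd => ?_, fun hd => ?_, by decide⟩
  · exact absurd ((fam_algDegeneratesTo_fam_iff_zmod2 1 0).mp hd) (by decide)
  · exact absurd ((fam_algDegeneratesTo_fam_iff_zmod2 0 1).mp hd) (by decide)

end Line

end Summit.MatrixMultiplication.MatrixMultiplication.Theorems.FarEdgeDescentLineAllChar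

end
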